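import Summits.ResolutionOfSingularities.ResolutionOfSingularities.Theorems.PurelyInseparableDim4ResConeFrozenConeTail
import Summits.ResolutionOfSingularities.ResolutionOfSingularities.Theorems.PurelyInseparableDim4ResConeFrozenConeKeepLaw
import Summits.ResolutionOfSingularities.ResolutionOfSingularities.Theorems.PurelyInseparableDim4ResConeKTwoPrimeLedger
import HarnessLib
import HarnessLib.Audit.Tags

/-!
# Purely inseparable four-folds — TAIL(p, d, 2) = ∅ FOR EVERY PRIME `p` AND EVERY SHADE `3 ≤ d < p` (the binary-cone half of the
# K2(p) ledger, UNCONDITIONAL in OUR frame), and THE K2(p) LEDGER v2: K2(p) ⟺ the `p − 3` POWER-CONE tails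
# (cell `res-dim4-pi`, K2(p) lane holder's closing file of rung-2 row E-CONE)

[OURS · counted 0 · cell `res-dim4-pi` · K2(p) lane holder res-dim4-p-12 g5.]  **HONEST LABEL.**  A theorem about OUR MODEL (the
coordinate point-blow-up walk `Step0 p` with cleaning on presented states `(F, r, exc)` of `z^p + F(x₁..x₄)`, ISOLATED regime): it
empties the `p − 3` BINARY-CONE tail statements TAIL(p, d, 2), `3 ≤ d < p`, of the K2(p) ledger for every prime at once, and
re-points the ledger to the remaining `p − 3` POWER-CONE tails TAIL(p, d, 3).  Nothing here proves K2(p) for any `p ≥ 7` (the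
power-cone tails are OPEN: four at `p = 7`), `NoIsolatedTrap p p`, CJS Key Theorem 6.40 or resolution of singularities in dimension
≥ 4 / characteristic `p` — NOT proved.  AI kernel work, weaker than expert review.

* **`no_binaryCone_tail (p)`** — the conditional assembly `no_binaryCone_tail_of_keepLaw` (`…FrozenConeTail`: res-dim4-p-5 g5's frozen
  light set + res-dim4-p-9 g5's «permanent letters are cone letters» + E_set + res-dim4-p-2 g6's L_set + the one-tracked frame) with
  its only hypothesis `hK` DISCHARGED by res-dim4-p-7 g5's `keepLaw_frozenCone` (`…FrozenConeKeepLaw`, K_set): for every prime `p`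
  and every shade `1 ≤ d < p` there is no witnessed isolated above-floor `Step0 p` chain of constant shade `d` with binary residual
  cone (`e_G ≡ 2`).  The cell's earlier kills — TAIL-B/TAIL-D at `p = 5` (p706443/p707410/p707872), the light pair/triple/quad ∀ p,
  the `(p, p−1)` heavy line ∀ p (p710256), TAIL(p, p−1, 2) (p712057), TAIL(p, p−2, 2) (p713045) — are all special cases.
* **`noAboveFloorTrap_iff_powerConeTails (p)`** — THE LEDGER v2: `NoAboveFloorTrap p p` iff for every field of characteristic `p`
  and every shade `3 ≤ d < p`, TAIL(p, d, 3) = ∅ (constant shade `d`, polar-kernel rank `3` = residual cone a `d`-th power of ONE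
  linear form); `p − 3` statements — FOUR at `p = 7`: TAIL(7,3,3), TAIL(7,4,3), TAIL(7,5,3), TAIL(7,6,3); at `p = 5` the two are
  the K24a two-slot game (p701277) and the C∞ window game (p703775), whence K2(5) (p708920) again.
* `noAboveFloorTrap_of_powerConeTails (p)` — the direction the lane uses.

[cite: CossartJannsenSaito2020, Thm. 3.14, Lemma 13.4 (3), Thm. 13.7] [cite: CossartPiltant2008, (16), Lemma 4.5 (2)]
[cite: CossartPiltant2009, Ch. 1 II.4 (ω, τ), Ch. 4 I.1 (κ = 5)] [cite: HauserPerlega2019PRIMS, §2 (transform D′ of D)]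
bears_on: LADDER-RESOLUTION:D157-DOOR2 (res-dim4-pi · K2(p) · binary-cone half CLOSED ∀ p · ledger v2 = power cones only).
Supports stmt-ResolutionOfSingularities-16155 (helper).
-/

set_option linter.dupNamespace false -- mandated namespace of this single-conjunct summit

noncomputable section

namespace Summit.ResolutionOfSingularities.ResolutionOfSingularities.Theorems.PIDim4

namespace ResCone

open MvPolynomial
open Literature.AlgebraicGeometry.Resolution
open Literature.AlgebraicGeometry.Resolution.CentreBlowup
open Literature.AlgebraicGeometry.Resolution.Hauser2010
open Literature.AlgebraicGeometry.Resolution.HauserPerlega2019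
open RidgeBudget (NoAboveFloorTrap)

/-! ## 1. The binary-cone half of the ledger, unconditional -/

/-- **TAIL(p, d, 2) = ∅ FOR EVERY PRIME `p` AND EVERY SHADE `1 ≤ d < p` (unconditional in OUR frame).**  There is no witnessed
isolated above-floor `Step0 p` chain `c j b` with `x^{r₀} ∣ F₀` whose shade is `≡ d` and whose polar-kernel rank is `e_G ≡ 2` from
some `k₀` on: `no_binaryCone_tail_of_keepLaw` with `hK := keepLaw_frozenCone` (res-dim4-p-7 g5, K_set). [OURS]
[cite: CossartJannsenSaito2020, Thm. 3.14, Lemma 13.4 (3), Thm. 13.7] [cite: CossartPiltant2008, (16), Lemma 4.5 (2)] -/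
theorem no_binaryCone_tail (p : ℕ) [Fact p.Prime] {K : Type} [Field K] [CharP K p] [DecidableEq K]
    {c : ℕ → State K} {j : ℕ → Fin 4} {b : ℕ → Fin 4 → K}
    (hc : ∀ k, IsIsolated p (c k).F ∧ Step0 p (c k) (c (k + 1))) (hw : FreeTail.IsWitnessedChain p c j b)
    (hr0 : ∀ e ∈ (c 0).F.support, (c 0).r ≤ e) (hfloor : ∀ k, ordZero (c k).F ≠ p) {k₀ d : ℕ} (hd : 1 ≤ d) (hdp : d < p)
    (hshade : ∀ k, k₀ ≤ k → (c k).shade = (d : ℕ∞))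
    (he : ∀ k, k₀ ≤ k → Module.finrank K (resVertex (c k)) = 2) : False :=
  no_binaryCone_tail_of_keepLaw p hc hw hr0 hfloor hd hdp hshade he (keepLaw_frozenCone p hc hw hr0 hfloor hd hdp hshade he)

/-! ## 2. The ledger v2: only the power cones remain -/

/-- **THE K2(p) LEDGER, v2 (every prime `p`): K2(p) ⟺ THE `p − 3` POWER-CONE TAILS ARE EMPTY.**  `NoAboveFloorTrap p p` iff, for
every field of characteristic `p` and every shade `3 ≤ d < p`, there is no witnessed isolated above-floor `Step0 p` chain with
`x^{r₀} ∣ F₀`, constant shade `d` and polar-kernel rank `e_G ≡ 3` from some `k₀` — v0 `noAboveFloorTrap_iff_highTails` with every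
`e = 2` slot discharged by `no_binaryCone_tail`.  FOUR statements at `p = 7`. [OURS · bookkeeping over the binary-cone kill]
[cite: CossartJannsenSaito2020, Thm. 3.14, Thm. 13.7] [cite: CossartPiltant2009, Ch. 1 II.4] -/
theorem noAboveFloorTrap_iff_powerConeTails (p : ℕ) [Fact p.Prime] :
    NoAboveFloorTrap p p ↔ ∀ (K : Type) [Field K] [CharP K p] [DecidableEq K] (d : ℕ), 3 ≤ d → d < p →
      ∀ (c : ℕ → State K) (j : ℕ → Fin 4) (b : ℕ → Fin 4 → K),
        (∀ k, IsIsolated p (c k).F ∧ Step0 p (c k) (c (k + 1))) → FreeTail.IsWitnessedChain p c j b →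
        (∀ e' ∈ (c 0).F.support, (c 0).r ≤ e') → (∀ k, ordZero (c k).F ≠ p) →
        ∀ k₀ : ℕ, (∀ k, k₀ ≤ k → (c k).shade = (d : ℕ∞)) →
          (∀ k, k₀ ≤ k → Module.finrank K (resVertex (c k)) = 3) → False := by
  rw [noAboveFloorTrap_iff_highTails]
  refine forall_congr' fun K => forall_congr' fun _ => forall_congr' fun _ => forall_congr' fun _ => ?_
  constructor
  · intro h d hd3 hdp c j b hc hw hr0 hfloor k₀ hshade he
    exact h d 3 hd3 hdp (Or.inr rfl) c j b hc hw hr0 hfloor k₀ hshade he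
  · intro h d e hd3 hdp he c j b hc hw hr0 hfloor k₀ hshade hrk
    rcases he with rfl | rfl
    · exact no_binaryCone_tail p hc hw hr0 hfloor (by omega) hdp hshade hrk
    · exact h d hd3 hdp c j b hc hw hr0 hfloor k₀ hshade hrk

/-- **K2(p) FROM THE POWER-CONE KILLS** (the direction the lane uses; every prime `p`): per-shade kills of the power-cone tails
TAIL(p, d, 3), `3 ≤ d < p`, give `NoAboveFloorTrap p p`. [OURS · bookkeeping] [cite: CossartJannsenSaito2020, Thm. 3.14] -/
theorem noAboveFloorTrap_of_powerConeTails (p : ℕ) [Fact p.Prime]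
    (h : ∀ (K : Type) [Field K] [CharP K p] [DecidableEq K] (d : ℕ), 3 ≤ d → d < p →
      ∀ (c : ℕ → State K) (j : ℕ → Fin 4) (b : ℕ → Fin 4 → K),
        (∀ k, IsIsolated p (c k).F ∧ Step0 p (c k) (c (k + 1))) → FreeTail.IsWitnessedChain p c j b →
        (∀ e' ∈ (c 0).F.support, (c 0).r ≤ e') → (∀ k, ordZero (c k).F ≠ p) →
        ∀ k₀ : ℕ, (∀ k, k₀ ≤ k → (c k).shade = (d : ℕ∞)) →
          (∀ k, k₀ ≤ k → Module.finrank K (resVertex (c k)) = 3) → False) :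
    NoAboveFloorTrap p p :=
  (noAboveFloorTrap_iff_powerConeTails p).mpr h

end ResCone

end Summit.ResolutionOfSingularities.ResolutionOfSingularities.Theorems.PIDim4

end
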